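import Summits.ResolutionOfSingularities.ResolutionOfSingularities.Theorems.HilbertSamuelEliminationSigmaMaxModificationsCorridor3WitnessGlue
import Summits.ResolutionOfSingularities.ResolutionOfSingularities.Theorems.HilbertSamuelEliminationSigmaMaxModificationsCorridor3TameWildNuGluing
import HarnessLib

/-!
# Route `HilbertSamuelElimination`, crux `SigmaMaxModificationsCorridor3`
# (stmt-ResolutionOfSingularities-19249; child of `SigmaMaxModifications` stmt-…-18506),
# line `tame_wild`: helper **G2** — the `ν`-gluing for TWO charts (shape-preserving merge)

[OURS · L1 W4.2] Helper G2 of `L/w42/CHAIN.md` v2 §4 (`L/w42/helpers-v2.lean`,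
`stub_G2_nuMod_of_two_localWitnesses`, verbatim) and the "shape-preserving two-chart merge" asked for
by lead-1's RESHAPE v3 (2026-08-26T23:31Z): two local `ν`-witnesses `ρ₁ : Y₁ → U₁`, `ρ₂ : Y₂ → U₂`
(proper, reduced, `dim ≤ d, N`, isomorphisms over `U_i ∩ Zc`, dense opens inside `X ∖ X(ν)` pulled
back to dense opens, `H^N` non-increasing, `ν` not a value) whose charts meet only inside
`Zc = X ∖ X(ν)` MERGE into one local witness over `U₁ ∪ U₂` of the same shape
(`exists_localWitness_sup`); with `Zc ∪ U₁ ∪ U₂ = X` the landed one-chart gluing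
`TameWild.nuMod_of_localWitness` (p459350) then yields `NuMod X N d ν`
(`stub_G2_nuMod_of_two_localWitnesses`). NOT a statement of any manuscript.

Construction: over `U₁ ∩ U₂ ⊆ Zc` both witnesses are isomorphisms, so `Y₁` and `Y₂` glue along
`ρ₁⁻¹(U₁ ∩ U₂) ≅ U₁ ∩ U₂ ≅ ρ₂⁻¹(U₁ ∩ U₂)` (`exists_glue_of_isIso` of `…Corridor3WitnessGlue.lean`
with `σ = ρ₂ ≫ ι_{U₂}`, `Z₀ = U₂ ∩ Zc`); the glued map `Y → X` factors through `U₁ ∪ U₂`, and the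
eight witness clauses are checked on the two charts (properness and isomorphy over an open are
local on the target and are read on a chart covering the preimage; reducedness, dimension, density
and the Hilbert–Samuel function are local).

## Sources

* The Stacks Project, Tags 01JA, 01LH (gluing of schemes). [StacksProject]
* V. Cossart, U. Jannsen, S. Saito, LNM 2270 (2020), Def. 2.28, Def. 6.14, Rem. 6.24.
  [CossartJannsenSaito2020]
-/

set_option linter.dupNamespace false -- mandated namespace of this single-conjunct summit

noncomputable section

open CategoryTheory CategoryTheory.Limits AlgebraicGeometry TopologicalSpace Topology
open Literature.AlgebraicGeometry.Resolution Literature.RingTheory.HilbertSamuel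
open Summit.ResolutionOfSingularities.ResolutionOfSingularities.Theorems.SigmaMaxModificationsCorridor3.TameWild

namespace Summit.ResolutionOfSingularities.ResolutionOfSingularities.Theorems.SigmaMaxModificationsCorridor3.Helpers

universe u

/-! ## Restriction over the preimage of an open along an isomorphism -/

/-- If `τ` is an isomorphism over `U` and `ρ ≫ τ` is proper over `U`, then `ρ` is proper over
`τ⁻¹(U)`. [folklore] -/
theorem isProper_morphismRestrict_preimage_of_comp {Y S X : Scheme.{u}} (ρ : Y ⟶ S) (τ : S ⟶ X)
    (U : X.Opens) [IsIso (τ ∣_ U)] (h : IsProper ((ρ ≫ τ) ∣_ U)) :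
    IsProper (ρ ∣_ (τ ⁻¹ᵁ U)) := by
  rw [morphismRestrict_comp] at h
  have he : ρ ∣_ (τ ⁻¹ᵁ U) = (ρ ∣_ (τ ⁻¹ᵁ U) ≫ τ ∣_ U) ≫ inv (τ ∣_ U) := by
    rw [Category.assoc, IsIso.hom_inv_id, Category.comp_id]
  rw [he]
  exact MorphismProperty.comp_mem @IsProper _ _ h (MorphismProperty.of_isIso @IsProper _)

/-- If `τ` is an isomorphism over `U` and `ρ ≫ τ` is an isomorphism over `U`, then `ρ` is an
isomorphism over `τ⁻¹(U)`. [folklore] -/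
theorem isIso_morphismRestrict_preimage_of_comp {Y S X : Scheme.{u}} (ρ : Y ⟶ S) (τ : S ⟶ X)
    (U : X.Opens) [IsIso (τ ∣_ U)] (h : IsIso ((ρ ≫ τ) ∣_ U)) :
    IsIso (ρ ∣_ (τ ⁻¹ᵁ U)) := by
  rw [morphismRestrict_comp] at h
  exact @IsIso.of_isIso_comp_right _ _ _ _ _ (ρ ∣_ (τ ⁻¹ᵁ U)) (τ ∣_ U) inferInstance h

/-- A composite `ρ ≫ ι_U` of a proper `ρ : Y → U` with the open immersion `U ↪ X` is proper over
every open `W ⊆ U`. [folklore] -/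
theorem isProper_morphismRestrict_comp_ι {X Y : Scheme.{u}} (U W : X.Opens) (hW : W ≤ U)
    (ρ : Y ⟶ U) [IsProper ρ] : IsProper ((ρ ≫ U.ι) ∣_ W) := by
  rw [morphismRestrict_comp]
  haveI h1 : IsIso (U.ι ∣_ W) := isIso_ι_morphismRestrict_of_le U W hW
  have h2 : IsProper (U.ι ∣_ W) := MorphismProperty.of_isIso @IsProper _
  have h3 : IsProper (ρ ∣_ (U.ι ⁻¹ᵁ W)) := inferInstance
  exact MorphismProperty.comp_mem @IsProper _ _ h3 h2

/-- A composite `ρ ≫ ι_U` with `ρ` an isomorphism over `U ∩ Zc` is an isomorphism over every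
open `W ⊆ U ∩ Zc`. [folklore] -/
theorem isIso_morphismRestrict_comp_ι {X Y : Scheme.{u}} (U Zc W : X.Opens) (hWU : W ≤ U)
    (hWZ : W ≤ Zc) (ρ : Y ⟶ U) (hiso : IsIso (ρ ∣_ (U.ι ⁻¹ᵁ Zc))) :
    IsIso ((ρ ≫ U.ι) ∣_ W) := by
  rw [morphismRestrict_comp]
  have h1 : IsIso (U.ι ∣_ W) := isIso_ι_morphismRestrict_of_le U W hWU
  have h2 : IsIso (ρ ∣_ (U.ι ⁻¹ᵁ W)) :=
    isIso_morphismRestrict_of_le ρ hiso (U.ι.preimage_mono hWZ)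
  exact @IsIso.comp_isIso _ _ _ _ _ _ _ h2 h1

/-! ## The shape-preserving merge of two local `ν`-witnesses -/

/-- **Two-chart merge of local `ν`-witnesses (shape-preserving).** Let `X` be a locally Noetherian
scheme, `Zc, U₁, U₂ ⊆ X` opens with `U₁ ∩ U₂ ⊆ Zc`, and `ρ_i : Y_i → U_i` (`i = 1, 2`) local
witnesses: proper, `Y_i` reduced of dimension `≤ d` and `≤ N`, `ρ_i` an isomorphism over `U_i ∩ Zc`,
dense opens of `X` inside `X ∖ X(ν)` pulled back to dense opens of `Y_i`, `H^N` non-increasing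
along `ρ_i`, and `ν ∉ Σ_{Y_i}(N)`. Then there is ONE local witness `ρ : Y → U₁ ∪ U₂` with the
same eight properties: glue `Y₁`, `Y₂` along `ρ₁⁻¹(U₁ ∩ U₂) ≅ U₁ ∩ U₂ ≅ ρ₂⁻¹(U₁ ∩ U₂)`
(`exists_glue_of_isIso`), factor the glued map through `U₁ ∪ U₂`, and check every clause on the two
charts. [OURS · L1 W4.2] ν-gluing v2 / RESHAPE v3 "two-chart merge"; NOT a statement of the
manuscript. [cite: StacksProject, Tag 01LH] [cite: CossartJannsenSaito2020, Def. 6.14, Rem. 6.24] -/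
theorem exists_localWitness_sup (X : Scheme.{u}) [IsLocallyNoetherian X] (N d : ℕ) (ν : ℕ → ℕ)
    (Zc U₁ U₂ : X.Opens) (h12 : U₁ ⊓ U₂ ≤ Zc)
    (Y₁ : Scheme.{u}) (ρ₁ : Y₁ ⟶ (U₁ : Scheme.{u})) [IsProper ρ₁] [IsReduced Y₁]
    (hd₁ : topologicalKrullDim Y₁ ≤ (d : WithBot ℕ∞))
    (hN₁ : topologicalKrullDim Y₁ ≤ (N : WithBot ℕ∞))
    (hiso₁ : IsIso (ρ₁ ∣_ (U₁.ι ⁻¹ᵁ Zc)))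
    (hdense₁ : ∀ V : X.Opens, Dense (V : Set X) → (V : Set X) ⊆ (Scheme.hsStratum X N ν)ᶜ →
      Dense ((ρ₁ ⁻¹ᵁ (U₁.ι ⁻¹ᵁ V) : Y₁.Opens) : Set Y₁))
    (hmono₁ : ∀ y : Y₁, Scheme.hsFun Y₁ N y ≤ Scheme.hsFun X N (U₁.ι.base (ρ₁.base y)))
    (hkill₁ : ν ∉ Scheme.hsValues Y₁ N)
    (Y₂ : Scheme.{u}) (ρ₂ : Y₂ ⟶ (U₂ : Scheme.{u})) [IsProper ρ₂] [IsReduced Y₂]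
    (hd₂ : topologicalKrullDim Y₂ ≤ (d : WithBot ℕ∞))
    (hN₂ : topologicalKrullDim Y₂ ≤ (N : WithBot ℕ∞))
    (hiso₂ : IsIso (ρ₂ ∣_ (U₂.ι ⁻¹ᵁ Zc)))
    (hdense₂ : ∀ V : X.Opens, Dense (V : Set X) → (V : Set X) ⊆ (Scheme.hsStratum X N ν)ᶜ →
      Dense ((ρ₂ ⁻¹ᵁ (U₂.ι ⁻¹ᵁ V) : Y₂.Opens) : Set Y₂))
    (hmono₂ : ∀ y : Y₂, Scheme.hsFun Y₂ N y ≤ Scheme.hsFun X N (U₂.ι.base (ρ₂.base y)))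
    (hkill₂ : ν ∉ Scheme.hsValues Y₂ N) :
    ∃ (Y : Scheme.{u}) (ρ : Y ⟶ (↑(U₁ ⊔ U₂) : Scheme.{u})), IsProper ρ ∧ IsReduced Y ∧
      topologicalKrullDim Y ≤ (d : WithBot ℕ∞) ∧ topologicalKrullDim Y ≤ (N : WithBot ℕ∞) ∧
      IsIso (ρ ∣_ ((U₁ ⊔ U₂).ι ⁻¹ᵁ Zc)) ∧
      (∀ V : X.Opens, Dense (V : Set X) → (V : Set X) ⊆ (Scheme.hsStratum X N ν)ᶜ →
        Dense ((ρ ⁻¹ᵁ ((U₁ ⊔ U₂).ι ⁻¹ᵁ V) : Y.Opens) : Set Y)) ∧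
      (∀ y : Y, Scheme.hsFun Y N y ≤ Scheme.hsFun X N ((U₁ ⊔ U₂).ι.base (ρ.base y))) ∧
      ν ∉ Scheme.hsValues Y N := by
  haveI : IsLocallyNoetherian Y₁ := LocallyOfFiniteType.isLocallyNoetherian ρ₁
  haveI : IsLocallyNoetherian Y₂ := LocallyOfFiniteType.isLocallyNoetherian ρ₂
  set S : X.Opens := U₁ ⊔ U₂ with hS
  -- the gluing data: both witnesses are isomorphisms over `U₁ ∩ U₂ ∩ Zc = U₁ ∩ U₂`
  haveI hA : IsIso ((ρ₁ ≫ U₁.ι) ∣_ (U₁ ⊓ (U₂ ⊓ Zc))) :=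
    isIso_morphismRestrict_comp_ι U₁ Zc _ inf_le_left (inf_le_right.trans inf_le_right) ρ₁ hiso₁
  haveI hB : IsIso ((ρ₂ ≫ U₂.ι) ∣_ (U₁ ⊓ (U₂ ⊓ Zc))) :=
    isIso_morphismRestrict_comp_ι U₂ Zc _ (inf_le_right.trans inf_le_left)
      (inf_le_right.trans inf_le_right) ρ₂ hiso₂
  have hσ : ∀ z : Y₂, (ρ₂ ≫ U₂.ι) z ∈ U₁ → (ρ₂ ≫ U₂.ι) z ∈ (U₂ ⊓ Zc : X.Opens) := by
    intro z hz
    rw [Scheme.Hom.comp_apply] at hz ⊢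
    exact Opens.mem_inf.mpr ⟨(ρ₂ z).2, h12 (Opens.mem_inf.mpr ⟨hz, (ρ₂ z).2⟩)⟩
  obtain ⟨Y, π, inl, inr, hinl, hinr, hπl, hπr, hcases, hcovU₁, hcovZ₀⟩ :=
    exists_glue_of_isIso (U₂ ⊓ Zc) U₁ ρ₁ (ρ₂ ≫ U₂.ι) hσ
  have hπl' : ∀ y : Y₁, π (inl y) = U₁.ι (ρ₁ y) := fun y => by
    rw [← Scheme.Hom.comp_apply, hπl, Scheme.Hom.comp_apply]
  have hπr' : ∀ z : Y₂, π (inr z) = U₂.ι (ρ₂ z) := fun z => by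
    rw [← Scheme.Hom.comp_apply, hπr, Scheme.Hom.comp_apply]
  -- `π` factors through `S = U₁ ∪ U₂`
  have hrange : Set.range π ⊆ Set.range S.ι := by
    rw [Scheme.Opens.range_ι]
    rintro _ ⟨x', rfl⟩
    rcases hcases x' with ⟨y, rfl⟩ | ⟨z, rfl⟩
    · rw [hπl']
      exact Opens.mem_sup.mpr (Or.inl (ρ₁ y).2)
    · rw [hπr']
      exact Opens.mem_sup.mpr (Or.inr (ρ₂ z).2)
  let ρ : Y ⟶ (S : Scheme.{u}) := IsOpenImmersion.lift S.ι π hrange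
  have hρ : ρ ≫ S.ι = π := IsOpenImmersion.lift_fac _ _ _
  have hρl : inl ≫ ρ ≫ S.ι = ρ₁ ≫ U₁.ι := by rw [hρ, hπl]
  have hρr : inr ≫ ρ ≫ S.ι = ρ₂ ≫ U₂.ι := by rw [hρ, hπr]
  have hρl' : ∀ y : Y₁, S.ι (ρ (inl y)) = U₁.ι (ρ₁ y) := fun y => by
    rw [← Scheme.Hom.comp_apply, ← Scheme.Hom.comp_apply, hρl, Scheme.Hom.comp_apply]
  have hρr' : ∀ z : Y₂, S.ι (ρ (inr z)) = U₂.ι (ρ₂ z) := fun z => by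
    rw [← Scheme.Hom.comp_apply, ← Scheme.Hom.comp_apply, hρr, Scheme.Hom.comp_apply]
  -- which points lie in which chart
  have hchart₁ : ∀ y : Y, (ρ ≫ S.ι) y ∈ U₁ → ∃ y₁, inl y₁ = y := fun y hy => by
    rw [hρ] at hy
    exact hcovU₁ y hy
  have hchart₂ : ∀ y : Y, (ρ ≫ S.ι) y ∈ U₂ → ∃ z, inr z = y := by
    intro y hy
    rw [hρ] at hy
    rcases hcases y with ⟨y₁, rfl⟩ | ⟨z, rfl⟩
    · rw [hπl'] at hy
      exact hcovZ₀ y₁ (Opens.mem_inf.mpr ⟨hy, h12 (Opens.mem_inf.mpr ⟨(ρ₁ y₁).2, hy⟩)⟩)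
    · exact ⟨z, rfl⟩
  refine ⟨Y, ρ, ?_, isReduced_of_inl_inr inl inr hcases,
    topologicalKrullDim_le_of_inl_inr inl inr hcases hd₁ hd₂,
    topologicalKrullDim_le_of_inl_inr inl inr hcases hN₁ hN₂, ?_, ?_, ?_, ?_⟩
  · -- properness: local on `S`, read on the chart over `U₁` resp. `U₂`
    have hP₁ : IsProper (ρ ∣_ (S.ι ⁻¹ᵁ U₁)) := by
      haveI := isIso_ι_morphismRestrict_of_le S U₁ le_sup_left
      refine isProper_morphismRestrict_preimage_of_comp ρ S.ι U₁
        (isProper_morphismRestrict_of_chart inl (ρ ≫ S.ι) U₁ hchart₁ ?_)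
      rw [← Category.assoc, show (inl ≫ ρ) ≫ S.ι = ρ₁ ≫ U₁.ι by rw [Category.assoc, hρl]]
      exact isProper_morphismRestrict_comp_ι U₁ U₁ le_rfl ρ₁
    have hP₂ : IsProper (ρ ∣_ (S.ι ⁻¹ᵁ U₂)) := by
      haveI := isIso_ι_morphismRestrict_of_le S U₂ le_sup_right
      refine isProper_morphismRestrict_preimage_of_comp ρ S.ι U₂
        (isProper_morphismRestrict_of_chart inr (ρ ≫ S.ι) U₂ hchart₂ ?_)
      rw [← Category.assoc, show (inr ≫ ρ) ≫ S.ι = ρ₂ ≫ U₂.ι by rw [Category.assoc, hρr]]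
      exact isProper_morphismRestrict_comp_ι U₂ U₂ le_rfl ρ₂
    apply IsZariskiLocalAtTarget.of_forall_exists_morphismRestrict (P := @IsProper)
    intro s
    rcases Opens.mem_sup.mp s.2 with hs | hs
    · exact ⟨S.ι ⁻¹ᵁ U₁, hs, hP₁⟩
    · exact ⟨S.ι ⁻¹ᵁ U₂, hs, hP₂⟩
  · -- isomorphism over `S ∩ Zc = (U₁ ∩ Zc) ∪ (U₂ ∩ Zc)`, read on the two charts
    have heq : S.ι ⁻¹ᵁ Zc = S.ι ⁻¹ᵁ (Zc ⊓ S) := by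
      ext s
      constructor
      · intro hs
        exact Opens.mem_inf.mpr ⟨hs, s.2⟩
      · intro hs
        exact (Opens.mem_inf.mp hs).1
    rw [heq]
    haveI := isIso_ι_morphismRestrict_of_le S (Zc ⊓ S) inf_le_right
    refine isIso_morphismRestrict_preimage_of_comp ρ S.ι (Zc ⊓ S) ?_
    show IsIso ((ρ ≫ S.ι) ∣_ (Zc ⊓ (U₁ ⊔ U₂)))
    rw [inf_sup_left]
    refine isIso_morphismRestrict_sup (ρ ≫ S.ι) ?_ ?_
    · refine isIso_morphismRestrict_of_chart inl (ρ ≫ S.ι) (Zc ⊓ U₁)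
        (fun y hy => hchart₁ y (Opens.mem_inf.mp hy).2) ?_
      rw [← Category.assoc, show (inl ≫ ρ) ≫ S.ι = ρ₁ ≫ U₁.ι by rw [Category.assoc, hρl]]
      exact isIso_morphismRestrict_comp_ι U₁ Zc _ inf_le_right inf_le_left ρ₁ hiso₁
    · refine isIso_morphismRestrict_of_chart inr (ρ ≫ S.ι) (Zc ⊓ U₂)
        (fun y hy => hchart₂ y (Opens.mem_inf.mp hy).2) ?_
      rw [← Category.assoc, show (inr ≫ ρ) ≫ S.ι = ρ₂ ≫ U₂.ι by rw [Category.assoc, hρr]]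
      exact isIso_morphismRestrict_comp_ι U₂ Zc _ inf_le_right inf_le_left ρ₂ hiso₂
  · -- dense opens inside `X ∖ X(ν)` pull back to dense opens: chart by chart
    intro V hVd hV
    refine dense_of_inl_inr inl inr hcases _ ?_ ?_
    · have hset : (fun y => inl y) ⁻¹' ((ρ ⁻¹ᵁ (S.ι ⁻¹ᵁ V) : Y.Opens) : Set Y) =
          ((ρ₁ ⁻¹ᵁ (U₁.ι ⁻¹ᵁ V) : Y₁.Opens) : Set Y₁) := by
        ext y
        show S.ι (ρ (inl y)) ∈ V ↔ U₁.ι (ρ₁ y) ∈ V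
        rw [hρl']
      rw [hset]
      exact hdense₁ V hVd hV
    · have hset : (fun z => inr z) ⁻¹' ((ρ ⁻¹ᵁ (S.ι ⁻¹ᵁ V) : Y.Opens) : Set Y) =
          ((ρ₂ ⁻¹ᵁ (U₂.ι ⁻¹ᵁ V) : Y₂.Opens) : Set Y₂) := by
        ext z
        show S.ι (ρ (inr z)) ∈ V ↔ U₂.ι (ρ₂ z) ∈ V
        rw [hρr']
      rw [hset]
      exact hdense₂ V hVd hV
  · -- `H^N` is non-increasing
    intro y
    rcases hcases y with ⟨y₁, rfl⟩ | ⟨z, rfl⟩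
    · rw [← hsFun_eq_of_isOpenImmersion_src inl N y₁]
      have h := hmono₁ y₁
      have h' : U₁.ι.base (ρ₁.base y₁) = S.ι.base (ρ.base (inl y₁)) := (hρl' y₁).symm
      rwa [h'] at h
    · rw [← hsFun_eq_of_isOpenImmersion_src inr N z]
      have h := hmono₂ z
      have h' : U₂.ι.base (ρ₂.base z) = S.ι.base (ρ.base (inr z)) := (hρr' z).symm
      rwa [h'] at h
  · -- `ν` is not a value upstairs
    rintro ⟨y, hy⟩
    rcases hcases y with ⟨y₁, rfl⟩ | ⟨z, rfl⟩
    · exact hkill₁ ⟨y₁, by rw [hsFun_eq_of_isOpenImmersion_src inl N y₁, hy]⟩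
    · exact hkill₂ ⟨z, by rw [hsFun_eq_of_isOpenImmersion_src inr N z, hy]⟩

/-! ## G2: the `ν`-gluing for two charts -/

/-- **G2 (ν-gluing v2, two charts with disjoint traces)** — plan-1's typed signature
(`L/w42/helpers-v2.lean`) verbatim. Local `ν`-witnesses over two opens `U₁, U₂` which together with
`Zc = X ∖ X(ν)` cover `X` and whose intersection misses the stratum glue (with the identity off the
stratum) to a `ν`-modification `NuMod X N d ν`: merge the two witnesses over `U₁ ∪ U₂`
(`exists_localWitness_sup`) and apply the landed one-chart gluing `TameWild.nuMod_of_localWitness`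
(p459350). [OURS · L1 W4.2] helper G2; NOT a statement of the manuscript.
[cite: CossartJannsenSaito2020, Def. 6.14, Rem. 6.24] [cite: StacksProject, Tag 01LH] -/
theorem stub_G2_nuMod_of_two_localWitnesses :
    ∀ (X : Scheme.{0}) [IsLocallyNoetherian X] [IsReduced X] (N d : ℕ) (ν : ℕ → ℕ),
      topologicalKrullDim X ≤ (d : WithBot ℕ∞) → topologicalKrullDim X ≤ (N : WithBot ℕ∞) →
      ∀ (Zc U₁ U₂ : X.Opens), (Zc : Set X) = (Scheme.hsStratum X N ν)ᶜ → Zc ⊔ (U₁ ⊔ U₂) = ⊤ →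
      U₁ ⊓ U₂ ≤ Zc →
      -- witness over U₁
      ∀ (Y₁ : Scheme.{0}) (ρ₁ : Y₁ ⟶ (U₁ : Scheme.{0})), IsProper ρ₁ → IsReduced Y₁ →
      topologicalKrullDim Y₁ ≤ (d : WithBot ℕ∞) → topologicalKrullDim Y₁ ≤ (N : WithBot ℕ∞) →
      IsIso (ρ₁ ∣_ (U₁.ι ⁻¹ᵁ Zc)) →
      (∀ V : X.Opens, Dense (V : Set X) → (V : Set X) ⊆ (Scheme.hsStratum X N ν)ᶜ →
        Dense ((ρ₁ ⁻¹ᵁ (U₁.ι ⁻¹ᵁ V) : Y₁.Opens) : Set Y₁)) →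
      (∀ y : Y₁, Scheme.hsFun Y₁ N y ≤ Scheme.hsFun X N (U₁.ι.base (ρ₁.base y))) →
      ν ∉ Scheme.hsValues Y₁ N →
      -- witness over U₂
      ∀ (Y₂ : Scheme.{0}) (ρ₂ : Y₂ ⟶ (U₂ : Scheme.{0})), IsProper ρ₂ → IsReduced Y₂ →
      topologicalKrullDim Y₂ ≤ (d : WithBot ℕ∞) → topologicalKrullDim Y₂ ≤ (N : WithBot ℕ∞) →
      IsIso (ρ₂ ∣_ (U₂.ι ⁻¹ᵁ Zc)) →
      (∀ V : X.Opens, Dense (V : Set X) → (V : Set X) ⊆ (Scheme.hsStratum X N ν)ᶜ →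
        Dense ((ρ₂ ⁻¹ᵁ (U₂.ι ⁻¹ᵁ V) : Y₂.Opens) : Set Y₂)) →
      (∀ y : Y₂, Scheme.hsFun Y₂ N y ≤ Scheme.hsFun X N (U₂.ι.base (ρ₂.base y))) →
      ν ∉ Scheme.hsValues Y₂ N →
      NuMod X N d ν := by
  intro X _ _ N d ν hdimXd hdimX Zc U₁ U₂ hZc hcov h12 Y₁ ρ₁ hρ₁ hY₁ hd₁ hN₁ hiso₁ hdense₁ hmono₁
    hkill₁ Y₂ ρ₂ hρ₂ hY₂ hd₂ hN₂ hiso₂ hdense₂ hmono₂ hkill₂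
  haveI := hρ₁
  haveI := hρ₂
  haveI := hY₁
  haveI := hY₂
  obtain ⟨Y, ρ, hρ, hred, hd, hN, hiso, hdense, hmono, hkill⟩ :=
    exists_localWitness_sup X N d ν Zc U₁ U₂ h12 Y₁ ρ₁ hd₁ hN₁ hiso₁ hdense₁ hmono₁ hkill₁
      Y₂ ρ₂ hd₂ hN₂ hiso₂ hdense₂ hmono₂ hkill₂
  exact nuMod_of_localWitness X N d ν hdimXd hdimX Zc (U₁ ⊔ U₂) hZc hcov Y ρ hρ hred hd hN hiso
    hdense hmono hkill

end Summit.ResolutionOfSingularities.ResolutionOfSingularities.Theorems.SigmaMaxModificationsCorridor3.Helpers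

end
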